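import Mathlib
import Summits.ValiantsHypothesis.ValiantsHypothesis.Theorems.RigidityForcesSymmetryRankRigidMinimalReprLaplaceFiveThreeSlicesSorted
import Summits.ValiantsHypothesis.ValiantsHypothesis.Theorems.RigidityForcesSymmetryRankRigidMinimalReprLaplaceFiveThreeSlicesTransport

/-!
# `LaplaceOptimalFive`, slice class `a = 3`: every labelling, modulo the 27 exceptional sorted configurations
# (crux `RankRigidMinimalRepr`, stmt-ValiantsHypothesis-18034; frontier rung `LaplaceOptimalFive`, stmt-24813)

`three_slices_three_pairs_all`: ASSUMING refutations of the 14 + 6 + 7 = 27 sorted configurations (10 types up to the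
symmetries) for which no dual certificate for `certified_no_decomposition2` exists (hypotheses `hexA`, `hexB`, `hexC`,
stated in the format of `three_slices_sorted_{A,B,C}`, `…LaplaceFiveThreeSlicesSorted.lean`), three slices (ANY slots
`i : Fin 3 → Fin 5`, vectors `α_k`, cofactors `W_k` blind to slot `i k`) and three pair terms (ANY cuts `p t ≠ q t`,
factors `u_t(v_{p t}, v_{q t})`, `w_t` blind to the two slots; zero terms allowed) never sum to the `5 × 5` permutation
pattern.  Proof: bring the slice slots to one of the patterns `![0,0,0]`, `![0,0,1]`, `![0,1,2]` by a case analysis on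
the coincidences among `i 0, i 1, i 2` (`perm_to_zero*`, re-indexing by `swap 1 2` / `swap 0 2` in two cases), then
`three_slices_reduce` (`…LaplaceFiveThreeSlicesTransport.lean`) and, per sorted configuration, either the hypothesis
(exceptional) or `three_slices_sorted_{A,B,C}` (certified).

Discharging `hexA / hexB / hexC` needs arguments beyond the kill-everything dual (evidence note of seat
val-width-24813-w1 on stmt-24813: peeled flattening for the parallel types, rank lemmas in the square-free algebra for
the star/triangle types); with `laplace_five_at_most_three_slices` it would give the rung «a cheap decomposition of
`P₅` has at most two slices».  No new definitions.  HONEST FRAMING: a conditional assembly step toward the frontier rung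
`LaplaceOptimalFive` (stmt-24813), which stays OPEN; nothing here bears on `VP ≠ VNP`.
-/

set_option autoImplicit false

-- the mandated summit-side namespace repeats a component by design (single-problem summit)
set_option linter.dupNamespace false

namespace Summit.ValiantsHypothesis.ValiantsHypothesis.Theorems.RigidityForcesSymmetryRankRigidMinimalRepr

namespace LaplaceFiveSlices

open Finset

/-! ### Every labelling, modulo the exceptional sorted configurations -/

/-- **Three slices + three pair terms ≠ P₅ for every labelling, given the exceptional configurations.**  Assume the
14 + 6 + 7 sorted configurations outside the reach of the dual certificates (`three_slices_certs_{A,B,C}`) are refuted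
(hypotheses `hexA`, `hexB`, `hexC`, in the format of `three_slices_sorted_{A,B,C}`).  Then for ALL slots
`i : Fin 3 → Fin 5` of three slices (vectors `α_k`, cofactors `W_k` blind to slot `i k`) and ALL cuts `p t ≠ q t` of three
pair terms (`u_t(v_{p t}, v_{q t})`, `w_t` blind to the two slots; zero terms allowed), the `5 × 5` permutation pattern is
not `Σ_k α_k(v_{i k}) W_k + Σ_t u_t w_t`. -/
theorem three_slices_three_pairs_all
    (hexA : ∀ p0 q0 p1 q1 p2 q2 : Fin 5, (p0, q0, p1, q1, p2, q2) ∈ ([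
      (1, 2, 1, 2, 3, 4), (1, 2, 1, 3, 1, 4), (1, 2, 1, 3, 2, 3), (1, 2, 1, 4, 2, 4), (1, 2, 2, 3, 2, 4),
      (1, 2, 3, 4, 3, 4), (1, 3, 1, 3, 2, 4), (1, 3, 1, 4, 3, 4), (1, 3, 2, 3, 3, 4), (1, 3, 2, 4, 2, 4),
      (1, 4, 1, 4, 2, 3), (1, 4, 2, 3, 2, 3), (1, 4, 2, 4, 3, 4), (2, 3, 2, 4, 3, 4)] :
      List (Fin 5 × Fin 5 × Fin 5 × Fin 5 × Fin 5 × Fin 5)) →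
      ∀ (α : Fin 3 → Fin 5 → ℂ) (W : Fin 3 → (Fin 5 → Fin 5) → ℂ),
        (∀ k, ∀ v v' : Fin 5 → Fin 5, (∀ j, j ≠ (![0, 0, 0] : Fin 3 → Fin 5) k → v j = v' j) → W k v = W k v') →
        ∀ (u w : Fin 3 → (Fin 5 → Fin 5) → ℂ),
        (∀ t, ∀ v v' : Fin 5 → Fin 5,
            v ((![p0, p1, p2] : Fin 3 → Fin 5) t) = v' ((![p0, p1, p2] : Fin 3 → Fin 5) t) →
            v ((![q0, q1, q2] : Fin 3 → Fin 5) t) = v' ((![q0, q1, q2] : Fin 3 → Fin 5) t) → u t v = u t v') →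
        (∀ t, ∀ v v' : Fin 5 → Fin 5,
            (∀ j, j ≠ (![p0, p1, p2] : Fin 3 → Fin 5) t → j ≠ (![q0, q1, q2] : Fin 3 → Fin 5) t → v j = v' j) → w t v = w t v') →
        ¬ ∀ v : Fin 5 → Fin 5, (if Function.Injective v then (1 : ℂ) else 0) =
            (∑ k, α k (v ((![0, 0, 0] : Fin 3 → Fin 5) k)) * W k v) + ∑ t, u t v * w t v)
    (hexB : ∀ p0 q0 p1 q1 p2 q2 : Fin 5, (p0, q0, p1, q1, p2, q2) ∈ ([
      (0, 1, 0, 1, 0, 1), (1, 2, 1, 3, 1, 4), (1, 2, 2, 3, 2, 4), (1, 3, 2, 3, 3, 4), (1, 4, 2, 4, 3, 4),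
      (2, 3, 2, 4, 3, 4)] :
      List (Fin 5 × Fin 5 × Fin 5 × Fin 5 × Fin 5 × Fin 5)) →
      ∀ (α : Fin 3 → Fin 5 → ℂ) (W : Fin 3 → (Fin 5 → Fin 5) → ℂ),
        (∀ k, ∀ v v' : Fin 5 → Fin 5, (∀ j, j ≠ (![0, 0, 1] : Fin 3 → Fin 5) k → v j = v' j) → W k v = W k v') →
        ∀ (u w : Fin 3 → (Fin 5 → Fin 5) → ℂ),
        (∀ t, ∀ v v' : Fin 5 → Fin 5,
            v ((![p0, p1, p2] : Fin 3 → Fin 5) t) = v' ((![p0, p1, p2] : Fin 3 → Fin 5) t) →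
            v ((![q0, q1, q2] : Fin 3 → Fin 5) t) = v' ((![q0, q1, q2] : Fin 3 → Fin 5) t) → u t v = u t v') →
        (∀ t, ∀ v v' : Fin 5 → Fin 5,
            (∀ j, j ≠ (![p0, p1, p2] : Fin 3 → Fin 5) t → j ≠ (![q0, q1, q2] : Fin 3 → Fin 5) t → v j = v' j) → w t v = w t v') →
        ¬ ∀ v : Fin 5 → Fin 5, (if Function.Injective v then (1 : ℂ) else 0) =
            (∑ k, α k (v ((![0, 0, 1] : Fin 3 → Fin 5) k)) * W k v) + ∑ t, u t v * w t v)
    (hexC : ∀ p0 q0 p1 q1 p2 q2 : Fin 5, (p0, q0, p1, q1, p2, q2) ∈ ([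
      (0, 1, 0, 1, 0, 1), (0, 1, 0, 2, 1, 2), (0, 1, 0, 2, 3, 4), (0, 1, 1, 2, 3, 4), (0, 2, 0, 2, 0, 2),
      (0, 2, 1, 2, 3, 4), (1, 2, 1, 2, 1, 2)] :
      List (Fin 5 × Fin 5 × Fin 5 × Fin 5 × Fin 5 × Fin 5)) →
      ∀ (α : Fin 3 → Fin 5 → ℂ) (W : Fin 3 → (Fin 5 → Fin 5) → ℂ),
        (∀ k, ∀ v v' : Fin 5 → Fin 5, (∀ j, j ≠ (![0, 1, 2] : Fin 3 → Fin 5) k → v j = v' j) → W k v = W k v') →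
        ∀ (u w : Fin 3 → (Fin 5 → Fin 5) → ℂ),
        (∀ t, ∀ v v' : Fin 5 → Fin 5,
            v ((![p0, p1, p2] : Fin 3 → Fin 5) t) = v' ((![p0, p1, p2] : Fin 3 → Fin 5) t) →
            v ((![q0, q1, q2] : Fin 3 → Fin 5) t) = v' ((![q0, q1, q2] : Fin 3 → Fin 5) t) → u t v = u t v') →
        (∀ t, ∀ v v' : Fin 5 → Fin 5,
            (∀ j, j ≠ (![p0, p1, p2] : Fin 3 → Fin 5) t → j ≠ (![q0, q1, q2] : Fin 3 → Fin 5) t → v j = v' j) → w t v = w t v') →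
        ¬ ∀ v : Fin 5 → Fin 5, (if Function.Injective v then (1 : ℂ) else 0) =
            (∑ k, α k (v ((![0, 1, 2] : Fin 3 → Fin 5) k)) * W k v) + ∑ t, u t v * w t v)
    (i : Fin 3 → Fin 5) (p q : Fin 3 → Fin 5) (hpq : ∀ t, p t ≠ q t)
    (α : Fin 3 → Fin 5 → ℂ) (W : Fin 3 → (Fin 5 → Fin 5) → ℂ)
    (hW : ∀ k, ∀ v v' : Fin 5 → Fin 5, (∀ j, j ≠ i k → v j = v' j) → W k v = W k v')
    (u w : Fin 3 → (Fin 5 → Fin 5) → ℂ)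
    (hu : ∀ t, ∀ v v' : Fin 5 → Fin 5,
      v (p t) = v' (p t) → v (q t) = v' (q t) → u t v = u t v')
    (hw : ∀ t, ∀ v v' : Fin 5 → Fin 5,
      (∀ j, j ≠ p t → j ≠ q t → v j = v' j) → w t v = w t v') :
    ¬ ∀ v : Fin 5 → Fin 5, (if Function.Injective v then (1 : ℂ) else 0) =
        (∑ k, α k (v (i k)) * W k v) + ∑ t, u t v * w t v := by
  have keyA : ∀ p0 q0 p1 q1 p2 q2 : Fin 5, p0 < q0 → p1 < q1 → p2 < q2 →
      (p0 : ℕ) * 5 + q0 ≤ (p1 : ℕ) * 5 + q1 → (p1 : ℕ) * 5 + q1 ≤ (p2 : ℕ) * 5 + q2 →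
      ∀ (α : Fin 3 → Fin 5 → ℂ) (W : Fin 3 → (Fin 5 → Fin 5) → ℂ),
        (∀ k, ∀ v v' : Fin 5 → Fin 5, (∀ j, j ≠ (![0, 0, 0] : Fin 3 → Fin 5) k → v j = v' j) → W k v = W k v') →
        ∀ (u w : Fin 3 → (Fin 5 → Fin 5) → ℂ),
        (∀ t, ∀ v v' : Fin 5 → Fin 5,
            v ((![p0, p1, p2] : Fin 3 → Fin 5) t) = v' ((![p0, p1, p2] : Fin 3 → Fin 5) t) →
            v ((![q0, q1, q2] : Fin 3 → Fin 5) t) = v' ((![q0, q1, q2] : Fin 3 → Fin 5) t) → u t v = u t v') →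
        (∀ t, ∀ v v' : Fin 5 → Fin 5,
            (∀ j, j ≠ (![p0, p1, p2] : Fin 3 → Fin 5) t → j ≠ (![q0, q1, q2] : Fin 3 → Fin 5) t → v j = v' j) → w t v = w t v') →
        ¬ ∀ v : Fin 5 → Fin 5, (if Function.Injective v then (1 : ℂ) else 0) =
            (∑ k, α k (v ((![0, 0, 0] : Fin 3 → Fin 5) k)) * W k v) + ∑ t, u t v * w t v := by
    intro p0 q0 p1 q1 p2 q2 h0 h1 h2 hs1 hs2 α' W' hW' u' w' hu' hw'
    by_cases hmem : (p0, q0, p1, q1, p2, q2) ∈ ([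
      (1, 2, 1, 2, 3, 4), (1, 2, 1, 3, 1, 4), (1, 2, 1, 3, 2, 3), (1, 2, 1, 4, 2, 4), (1, 2, 2, 3, 2, 4),
      (1, 2, 3, 4, 3, 4), (1, 3, 1, 3, 2, 4), (1, 3, 1, 4, 3, 4), (1, 3, 2, 3, 3, 4), (1, 3, 2, 4, 2, 4),
      (1, 4, 1, 4, 2, 3), (1, 4, 2, 3, 2, 3), (1, 4, 2, 4, 3, 4), (2, 3, 2, 4, 3, 4)] :
      List (Fin 5 × Fin 5 × Fin 5 × Fin 5 × Fin 5 × Fin 5))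
    · exact hexA p0 q0 p1 q1 p2 q2 hmem α' W' hW' u' w' hu' hw'
    · exact three_slices_sorted_A p0 q0 p1 q1 p2 q2 h0 h1 h2 hs1 hs2 hmem α' W' hW' u' w' hu' hw'
  have keyB : ∀ p0 q0 p1 q1 p2 q2 : Fin 5, p0 < q0 → p1 < q1 → p2 < q2 →
      (p0 : ℕ) * 5 + q0 ≤ (p1 : ℕ) * 5 + q1 → (p1 : ℕ) * 5 + q1 ≤ (p2 : ℕ) * 5 + q2 →
      ∀ (α : Fin 3 → Fin 5 → ℂ) (W : Fin 3 → (Fin 5 → Fin 5) → ℂ),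
        (∀ k, ∀ v v' : Fin 5 → Fin 5, (∀ j, j ≠ (![0, 0, 1] : Fin 3 → Fin 5) k → v j = v' j) → W k v = W k v') →
        ∀ (u w : Fin 3 → (Fin 5 → Fin 5) → ℂ),
        (∀ t, ∀ v v' : Fin 5 → Fin 5,
            v ((![p0, p1, p2] : Fin 3 → Fin 5) t) = v' ((![p0, p1, p2] : Fin 3 → Fin 5) t) →
            v ((![q0, q1, q2] : Fin 3 → Fin 5) t) = v' ((![q0, q1, q2] : Fin 3 → Fin 5) t) → u t v = u t v') →
        (∀ t, ∀ v v' : Fin 5 → Fin 5,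
            (∀ j, j ≠ (![p0, p1, p2] : Fin 3 → Fin 5) t → j ≠ (![q0, q1, q2] : Fin 3 → Fin 5) t → v j = v' j) → w t v = w t v') →
        ¬ ∀ v : Fin 5 → Fin 5, (if Function.Injective v then (1 : ℂ) else 0) =
            (∑ k, α k (v ((![0, 0, 1] : Fin 3 → Fin 5) k)) * W k v) + ∑ t, u t v * w t v := by
    intro p0 q0 p1 q1 p2 q2 h0 h1 h2 hs1 hs2 α' W' hW' u' w' hu' hw'
    by_cases hmem : (p0, q0, p1, q1, p2, q2) ∈ ([
      (0, 1, 0, 1, 0, 1), (1, 2, 1, 3, 1, 4), (1, 2, 2, 3, 2, 4), (1, 3, 2, 3, 3, 4), (1, 4, 2, 4, 3, 4),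
      (2, 3, 2, 4, 3, 4)] :
      List (Fin 5 × Fin 5 × Fin 5 × Fin 5 × Fin 5 × Fin 5))
    · exact hexB p0 q0 p1 q1 p2 q2 hmem α' W' hW' u' w' hu' hw'
    · exact three_slices_sorted_B p0 q0 p1 q1 p2 q2 h0 h1 h2 hs1 hs2 hmem α' W' hW' u' w' hu' hw'
  have keyC : ∀ p0 q0 p1 q1 p2 q2 : Fin 5, p0 < q0 → p1 < q1 → p2 < q2 →
      (p0 : ℕ) * 5 + q0 ≤ (p1 : ℕ) * 5 + q1 → (p1 : ℕ) * 5 + q1 ≤ (p2 : ℕ) * 5 + q2 →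
      ∀ (α : Fin 3 → Fin 5 → ℂ) (W : Fin 3 → (Fin 5 → Fin 5) → ℂ),
        (∀ k, ∀ v v' : Fin 5 → Fin 5, (∀ j, j ≠ (![0, 1, 2] : Fin 3 → Fin 5) k → v j = v' j) → W k v = W k v') →
        ∀ (u w : Fin 3 → (Fin 5 → Fin 5) → ℂ),
        (∀ t, ∀ v v' : Fin 5 → Fin 5,
            v ((![p0, p1, p2] : Fin 3 → Fin 5) t) = v' ((![p0, p1, p2] : Fin 3 → Fin 5) t) →
            v ((![q0, q1, q2] : Fin 3 → Fin 5) t) = v' ((![q0, q1, q2] : Fin 3 → Fin 5) t) → u t v = u t v') →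
        (∀ t, ∀ v v' : Fin 5 → Fin 5,
            (∀ j, j ≠ (![p0, p1, p2] : Fin 3 → Fin 5) t → j ≠ (![q0, q1, q2] : Fin 3 → Fin 5) t → v j = v' j) → w t v = w t v') →
        ¬ ∀ v : Fin 5 → Fin 5, (if Function.Injective v then (1 : ℂ) else 0) =
            (∑ k, α k (v ((![0, 1, 2] : Fin 3 → Fin 5) k)) * W k v) + ∑ t, u t v * w t v := by
    intro p0 q0 p1 q1 p2 q2 h0 h1 h2 hs1 hs2 α' W' hW' u' w' hu' hw'
    by_cases hmem : (p0, q0, p1, q1, p2, q2) ∈ ([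
      (0, 1, 0, 1, 0, 1), (0, 1, 0, 2, 1, 2), (0, 1, 0, 2, 3, 4), (0, 1, 1, 2, 3, 4), (0, 2, 0, 2, 0, 2),
      (0, 2, 1, 2, 3, 4), (1, 2, 1, 2, 1, 2)] :
      List (Fin 5 × Fin 5 × Fin 5 × Fin 5 × Fin 5 × Fin 5))
    · exact hexC p0 q0 p1 q1 p2 q2 hmem α' W' hW' u' w' hu' hw'
    · exact three_slices_sorted_C p0 q0 p1 q1 p2 q2 h0 h1 h2 hs1 hs2 hmem α' W' hW' u' w' hu' hw'
  -- the slot pattern of `i`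
  by_cases h01 : i 0 = i 1
  · by_cases h02 : i 0 = i 2
    · -- pattern {x,x,x}
      obtain ⟨σ, hσ⟩ := perm_to_zero (i 0)
      refine three_slices_reduce ![0, 0, 0] keyA σ 1 i (fun k => ?_) p q hpq α W hW u w hu hw
      fin_cases k
      · simpa using hσ
      · simpa [← h01] using hσ
      · simpa [← h02] using hσ
    · -- pattern {x,x,y}: `i 0 = i 1 ≠ i 2`
      obtain ⟨σ, hσ0, hσ1⟩ := perm_to_zero_one (i 0) (i 2) h02
      refine three_slices_reduce ![0, 0, 1] keyB σ 1 i (fun k => ?_) p q hpq α W hW u w hu hw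
      fin_cases k
      · simpa using hσ0
      · simpa [← h01] using hσ0
      · simpa using hσ1
  · by_cases h02 : i 0 = i 2
    · -- `i 0 = i 2 ≠ i 1`: re-index the slices by `swap 1 2`
      obtain ⟨σ, hσ0, hσ1⟩ := perm_to_zero_one (i 0) (i 1) h01
      refine three_slices_reduce ![0, 0, 1] keyB σ (Equiv.swap 1 2) i (fun k => ?_) p q hpq α W hW u w hu hw
      match k with
      | 0 => rw [show (Equiv.swap (1 : Fin 3) 2) 0 = 0 from by decide]; simpa using hσ0
      | 1 => rw [show (Equiv.swap (1 : Fin 3) 2) 1 = 2 from by decide]; simpa [← h02] using hσ0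
      | 2 => rw [show (Equiv.swap (1 : Fin 3) 2) 2 = 1 from by decide]; simpa using hσ1
    · by_cases h12 : i 1 = i 2
      · -- `i 1 = i 2 ≠ i 0`: re-index the slices by `swap 0 2`
        obtain ⟨σ, hσ0, hσ1⟩ := perm_to_zero_one (i 1) (i 0) (fun h => h01 h.symm)
        refine three_slices_reduce ![0, 0, 1] keyB σ (Equiv.swap 0 2) i (fun k => ?_) p q hpq α W hW u w hu hw
        match k with
        | 0 => rw [show (Equiv.swap (0 : Fin 3) 2) 0 = 2 from by decide]; simpa [← h12] using hσ0
        | 1 => rw [show (Equiv.swap (0 : Fin 3) 2) 1 = 1 from by decide]; simpa using hσ0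
        | 2 => rw [show (Equiv.swap (0 : Fin 3) 2) 2 = 0 from by decide]; simpa using hσ1
      · -- pattern {x,y,z}
        obtain ⟨σ, hσ0, hσ1, hσ2⟩ := perm_to_zero_one_two (i 0) (i 1) (i 2) h01 h02 h12
        refine three_slices_reduce ![0, 1, 2] keyC σ 1 i (fun k => ?_) p q hpq α W hW u w hu hw
        fin_cases k
        · simpa using hσ0
        · simpa using hσ1
        · simpa using hσ2

end LaplaceFiveSlices

end Summit.ValiantsHypothesis.ValiantsHypothesis.Theorems.RigidityForcesSymmetryRankRigidMinimalRepr
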